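import Mathlib
import HarnessLib
import Literature.Analysis.FluidPDE.Tao2016AveragedNS.RestartedCascadeFlows
import Summits.NavierStokesRegularity.NavierStokesRegularity.Theses.CompletionRelayChain
import Summits.NavierStokesRegularity.NavierStokesRegularity.Theorems.TaoLadderRungThreeGappedFrontRobustV2Closeness
import Summits.NavierStokesRegularity.NavierStokesRegularity.Theorems.TaoLadderRungThreeGappedFrontRobustStepTransfer

/-!
# `CompletionRelayChain` — crux `RelayFrontStep` (item stmt-NavierStokesRegularity-24850):
  REDUCTION TO ONE EXACT-FLOW CERTIFICATE (helper, `--supports`; the crux stays OPEN)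

The deciding crux `RelayFrontStep` asks, for EVERY table `α ∈ E₂(64)` whose cascade nonlinearity
`quadTerm 1 α` has the completion-relay rows, for a transition description `P`, a margin `η > 0`
and an epoch envelope with `TaoCascade.RobustStep 1 θ c η j₀ α P env` (every `(η,η)`-pseudo-flow
steps) holding together with `P` at a one-shell datum. Two observations, proved here, turn this
`∀`-over-pseudo-flows statement into a certificate problem about the EXACT flows of ONE explicit
lattice ODE:

1. **Transport along the rows.** A restarted pseudo-flow `TaoCascade.PseudoFlowOn τ ε₀ α κ₁ κ₂ …`
   reads the table only through `quadTerm ε₀ α` (clauses (4.8), (4.9)); hence `PseudoFlowOn`,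
   `StepSlack`, `GapData` and `GapData₂` are invariant under replacing `α` by any `α'` with the same
   nonlinearity (`pseudoFlowOn_congr_quadTerm`, `gapData_congr_quadTerm`, `gapData₂_congr_quadTerm`),
   and two tables with the completion-relay rows have the same nonlinearity
   (`quadTerm_eq_of_relayRows`).
2. **Format-v2 certificates give robust steps.** The CLOSED crux K_B₂ of route TaoLadderRungThree
   (`GappedFrontRobustV2`; its route-independent core is the tree theorem
   `GappedFrontRobust.gappedFrontRobustV2_closeness` + `GappedFrontRobust.stepTo_transfer`, composed
   here exactly as in `…Cruxes.GappedFrontRobustV2.ThreeZone.GappedFrontRobustV2_of`, (step) clause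
   only) turns format-v2 gap data `GapData₂ σ ε₀ i₀ α X₀ Z w r ρ θ₀ θ c₀ c env₀` with a thin tail
   into a margin `η > 0` and an envelope with `RobustStep ε₀ θ c η i₀ α (ballDesc Z w r) env`
   (`robustStep_of_gapData₂`); the rescaled datum lies in the ball (`GapData₂.datum_mem_ball`), and
   `0 ≤ θ₀ < θ ≤ 1/2`, `0 < c₀ < c` are conjuncts of the data.

CONSEQUENCE (`completionRelayChain_relayFrontStep_of_gapData₂`): `RelayFrontStep` follows from ONE
format-v2 certificate with thin tail, at the dyadic scale ratio `ε₀ = 1`, for ANY ONE table `α⋆`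
with the completion-relay rows (`α⋆` need not even be comparable — e.g. the relay table of
`…Theorems.completionRelayChain_relayTable_proof`). This is the same certificate SHAPE as the host
route's deciding crux `TaoLadderRungThree.DyadicGapCertificateV2R64` (there for the D64 envelope
table, margin 5 %), here for the relay lattice (kit j296955/j297643: per-hop energy ratio 0.955,
margin 0.45 over the `θ = 1/2` threshold). It does NOT produce the certificate: the exact-flow
enclosure of the relay hop ((exist₀) on the clock window, (step₀) with slack, TameBehind,
TailCompat, TailThin) is the open dynamical content of the crux.

HONEST FRAMING: plumbing between MODEL-lattice predicates (Tao 2016 §4/§6 vocabulary of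
`RestartedCascadeFlows`); helper for the crux, no stub credit; the crux `RelayFrontStep`, the rung
TL-M3-R64 and every NS statement remain unproved. Nothing here is a statement about the
Navier–Stokes equations.
-/

noncomputable section

-- the summit-side namespace `Summit.NavierStokesRegularity.NavierStokesRegularity.…` (single-conjunct summit,
-- D-0017) repeats a component by design; the dupNamespace linter would flag every declaration.
set_option linter.dupNamespace false

open Set Literature.Analysis.FluidPDE Literature.Analysis.FluidPDE.TaoCascade

namespace Summit.NavierStokesRegularity.NavierStokesRegularity.Theorems

namespace RelayFrontStep

/-! ### Transport of the restart vocabulary along equality of the nonlinearity -/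

variable {m : ℕ} {τ ε₀ κ₁ κ₂ : ℝ} {α α' : Fin m → Fin m → Fin m → ℤ × ℤ × ℤ → ℝ}
  {S₀ F₀ B₀ : Fin m → ℤ → ℝ} {S F : Fin m → ℤ → ℝ → ℝ}

/-- A restarted pseudo-flow reads the table only through its nonlinearity `quadTerm ε₀ α` (clauses
(4.8) and (4.9)): it is a pseudo-flow for every table with the same nonlinearity.
[cite: Tao2016AveragedNS, §4 Lemma 4.1 (4.8)–(4.9) (the displays the predicate transcribes)] -/
theorem pseudoFlowOn_congr_quadTerm (h : PseudoFlowOn τ ε₀ α κ₁ κ₂ S₀ F₀ B₀ S F)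
    (hq : ∀ (X : Fin m → ℤ → ℝ → ℝ) (i : Fin m) (k : ℤ) (s : ℝ),
      quadTerm ε₀ α' X i k s = quadTerm ε₀ α X i k s) :
    PseudoFlowOn τ ε₀ α' κ₁ κ₂ S₀ F₀ B₀ S F where
  contDiffOn_S := h.contDiffOn_S
  contDiffOn_F := h.contDiffOn_F
  nonneg_F := h.nonneg_F
  apriori_S := h.apriori_S
  apriori_F := h.apriori_F
  init_S := h.init_S
  init_F := h.init_F
  motion := fun i k s hs => by rw [hq]; exact h.motion i k s hs
  energy := fun i k s hs => by rw [hq]; exact h.energy i k s hs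
  defect_lower := h.defect_lower
  defect_upper := h.defect_upper

/-- The exact step with slack `StepSlack` transports along equality of the nonlinearity.
[cite: Tao2016AveragedNS, §6.3–6.4 Props. 6.4–6.5 (statement shape); cell vocabulary] -/
theorem stepSlack_congr_quadTerm {σ : ℝ} {i₀ : Fin m} {Z : Set (Fin m → ℤ → ℝ)} {w : ℤ → ℝ}
    {r ρ θ₀ c₀ : ℝ} {env₀ : ℤ → ℝ} (h : StepSlack σ ε₀ i₀ α Z w r ρ θ₀ c₀ env₀)
    (hq : ∀ (X : Fin m → ℤ → ℝ → ℝ) (i : Fin m) (k : ℤ) (s : ℝ),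
      quadTerm ε₀ α' X i k s = quadTerm ε₀ α X i k s) :
    StepSlack σ ε₀ i₀ α' Z w r ρ θ₀ c₀ env₀ := by
  intro S₀' τ' S' F' hball hτ hflow
  exact h S₀' τ' S' F' hball hτ (pseudoFlowOn_congr_quadTerm hflow fun X i k s => (hq X i k s).symm)

/-- Gap data `GapData` transports along equality of the nonlinearity ((exist₀) covariantly,
(step₀) contravariantly — both by `pseudoFlowOn_congr_quadTerm`).
[cite: Tao2016AveragedNS, §6.3–6.4 Props. 6.4–6.5 (statement shape); cell vocabulary] -/
theorem gapData_congr_quadTerm {i₀ : Fin m} {X₀ : Fin m → ℝ} {Z : Set (Fin m → ℤ → ℝ)}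
    {w : ℤ → ℝ} {r ρ θ₀ θ c₀ c : ℝ} {env₀ : ℤ → ℝ}
    (h : GapData ε₀ i₀ α X₀ Z w r ρ θ₀ θ c₀ c env₀)
    (hq : ∀ (X : Fin m → ℤ → ℝ → ℝ) (i : Fin m) (k : ℤ) (s : ℝ),
      quadTerm ε₀ α' X i k s = quadTerm ε₀ α X i k s) :
    GapData ε₀ i₀ α' X₀ Z w r ρ θ₀ θ c₀ c env₀ := by
  obtain ⟨hr, hρ0, hρ1, hθ₀, hθ₀θ, hθ, hc₀, hc₀c, hw1, hdat, htail, hex, hstep⟩ := h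
  refine ⟨hr, hρ0, hρ1, hθ₀, hθ₀θ, hθ, hc₀, hc₀c, hw1, hdat, htail, ?_, ?_⟩
  · intro S₀' hball
    obtain ⟨S', F', hSF⟩ := hex S₀' hball
    exact ⟨S', F', pseudoFlowOn_congr_quadTerm hSF hq⟩
  · intro S₀' τ' S' F' hball hτ hflow
    exact hstep S₀' τ' S' F' hball hτ
      (pseudoFlowOn_congr_quadTerm hflow fun X i k s => (hq X i k s).symm)

/-- Format-v2 gap data `GapData₂` transports along equality of the nonlinearity.
[cite: Tao2016AveragedNS, §6.3–6.4 Props. 6.4–6.5 (statement shape); cell vocabulary, certificate format v2] -/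
theorem gapData₂_congr_quadTerm {σ : ℝ} {i₀ : Fin m} {X₀ : Fin m → ℝ} {Z : Set (Fin m → ℤ → ℝ)}
    {w : ℤ → ℝ} {r ρ θ₀ θ c₀ c : ℝ} {env₀ : ℤ → ℝ}
    (h : GapData₂ σ ε₀ i₀ α X₀ Z w r ρ θ₀ θ c₀ c env₀)
    (hq : ∀ (X : Fin m → ℤ → ℝ → ℝ) (i : Fin m) (k : ℤ) (s : ℝ),
      quadTerm ε₀ α' X i k s = quadTerm ε₀ α X i k s) :
    GapData₂ σ ε₀ i₀ α' X₀ Z w r ρ θ₀ θ c₀ c env₀ :=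
  ⟨gapData_congr_quadTerm h.1 hq, h.2.1, h.2.2.1, stepSlack_congr_quadTerm h.2.2.2.1 hq, h.2.2.2.2⟩

/-! ### Two tables with the completion-relay rows have the same nonlinearity -/

/-- **The completion-relay rows pin the nonlinearity.** If the cascade nonlinearities of two
four-mode tables both have the completion-relay rows of route `CompletionRelayChain` (carrier,
trigger, relay, idle), they agree on every family, mode, shell and time. [this file] -/
theorem quadTerm_eq_of_relayRows (α α' : Fin 4 → Fin 4 → Fin 4 → ℤ × ℤ × ℤ → ℝ)
    (hα : (∀ (X : Fin 4 → ℤ → ℝ → ℝ) (n : ℤ) (t : ℝ), quadTerm 1 α X 0 n t =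
        -((1 + 1 : ℝ) ^ ((5 : ℝ) * n / 2) * (X 1 n t * X 1 n t)) +
          (1 + 1 : ℝ) ^ ((5 : ℝ) * ((n : ℝ) - 1) / 2) * (X 1 (n - 1) t * X 1 (n - 1) t)) ∧
      (∀ (X : Fin 4 → ℤ → ℝ → ℝ) (n : ℤ) (t : ℝ), quadTerm 1 α X 1 n t =
        (1 + 1 : ℝ) ^ ((5 : ℝ) * n / 2) * (X 0 n t * X 1 n t - X 1 n t * X 0 (n + 1) t) -
          (1 / 32 : ℝ) * ((1 + 1 : ℝ) ^ ((5 : ℝ) * n / 2) * (X 0 (n + 1) t * X 2 n t)) +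
          (1 / 32 : ℝ) * ((1 + 1 : ℝ) ^ ((5 : ℝ) * ((n : ℝ) - 1) / 2) *
            (X 2 (n - 1) t * X 1 (n - 1) t))) ∧
      (∀ (X : Fin 4 → ℤ → ℝ → ℝ) (n : ℤ) (t : ℝ), quadTerm 1 α X 2 n t =
        (1 / 32 : ℝ) * ((1 + 1 : ℝ) ^ ((5 : ℝ) * n / 2) *
          (X 0 (n + 1) t * X 1 n t - X 1 n t * X 1 (n + 1) t))) ∧
      (∀ (X : Fin 4 → ℤ → ℝ → ℝ) (n : ℤ) (t : ℝ), quadTerm 1 α X 3 n t = 0))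
    (hα' : (∀ (X : Fin 4 → ℤ → ℝ → ℝ) (n : ℤ) (t : ℝ), quadTerm 1 α' X 0 n t =
        -((1 + 1 : ℝ) ^ ((5 : ℝ) * n / 2) * (X 1 n t * X 1 n t)) +
          (1 + 1 : ℝ) ^ ((5 : ℝ) * ((n : ℝ) - 1) / 2) * (X 1 (n - 1) t * X 1 (n - 1) t)) ∧
      (∀ (X : Fin 4 → ℤ → ℝ → ℝ) (n : ℤ) (t : ℝ), quadTerm 1 α' X 1 n t =
        (1 + 1 : ℝ) ^ ((5 : ℝ) * n / 2) * (X 0 n t * X 1 n t - X 1 n t * X 0 (n + 1) t) -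
          (1 / 32 : ℝ) * ((1 + 1 : ℝ) ^ ((5 : ℝ) * n / 2) * (X 0 (n + 1) t * X 2 n t)) +
          (1 / 32 : ℝ) * ((1 + 1 : ℝ) ^ ((5 : ℝ) * ((n : ℝ) - 1) / 2) *
            (X 2 (n - 1) t * X 1 (n - 1) t))) ∧
      (∀ (X : Fin 4 → ℤ → ℝ → ℝ) (n : ℤ) (t : ℝ), quadTerm 1 α' X 2 n t =
        (1 / 32 : ℝ) * ((1 + 1 : ℝ) ^ ((5 : ℝ) * n / 2) *
          (X 0 (n + 1) t * X 1 n t - X 1 n t * X 1 (n + 1) t))) ∧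
      (∀ (X : Fin 4 → ℤ → ℝ → ℝ) (n : ℤ) (t : ℝ), quadTerm 1 α' X 3 n t = 0)) :
    ∀ (X : Fin 4 → ℤ → ℝ → ℝ) (i : Fin 4) (k : ℤ) (s : ℝ),
      quadTerm 1 α' X i k s = quadTerm 1 α X i k s := by
  intro X i k s
  obtain ⟨h0, h1, h2, h3⟩ := hα
  obtain ⟨h0', h1', h2', h3'⟩ := hα'
  fin_cases i
  · exact (h0' X k s).trans (h0 X k s).symm
  · exact (h1' X k s).trans (h1 X k s).symm
  · exact (h2' X k s).trans (h2 X k s).symm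
  · exact (h3' X k s).trans (h3 X k s).symm

end RelayFrontStep

/-! ### Format-v2 gap data give the (step) clause (route-independent composition of K_B₂) -/

/-- **Robust step from format-v2 gap data with a thin tail** — the (step) clause of the closed crux
K_B₂ `GappedFrontRobustV2` of route TaoLadderRungThree, composed from the route-independent tree
theorems `GappedFrontRobust.gappedFrontRobustV2_closeness` (selection of `η`, `env` and the three
closeness facts) and `GappedFrontRobust.stepTo_transfer`, exactly as in
`…Cruxes.GappedFrontRobustV2.ThreeZone.GappedFrontRobustV2_of`: the exact zero-slack flow from the
same ball state exists on the clock window ((exist₀)), steps with amplitude slack (`StepSlack`), and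
the `(η,η)`-pseudo-flow inherits the step. MODEL lattice only.
[cite: Tao2016AveragedNS, §6.3–6.4 Props. 6.4–6.5 (statement shape); §4 Lemma 4.1 (4.5), (4.8)–(4.10)] -/
theorem RelayFrontStep.robustStep_of_gapData₂ {R σ ε₀ : ℝ} {i₀ : Fin 4}
    {α : Fin 4 → Fin 4 → Fin 4 → ℤ × ℤ × ℤ → ℝ} {X₀ : Fin 4 → ℝ} {Z : Set (Fin 4 → ℤ → ℝ)}
    {w : ℤ → ℝ} {r ρ θ₀ θ c₀ c : ℝ} {env₀ : ℤ → ℝ}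
    (hα : InTableClass R α) (hε : 0 < ε₀) (hgap : GapData₂ σ ε₀ i₀ α X₀ Z w r ρ θ₀ θ c₀ c env₀)
    (hthin : TailThin ε₀ w r) :
    ∃ (η : ℝ) (env : ℤ → ℝ), 0 < η ∧ RobustStep ε₀ θ c η i₀ α (ballDesc Z w r) env := by
  obtain ⟨η, hη, env, -, hclose⟩ :=
    GappedFrontRobust.gappedFrontRobustV2_closeness R σ ε₀ i₀ α X₀ Z w r ρ θ₀ θ c₀ c env₀ hα hε
      hgap hthin
  refine ⟨η, env, hη, ?_⟩
  intro L S₀ F₀ B₀ hball hB τ hτc S' F' hflow'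
  obtain ⟨-, -, -, -, hθ₀θ, -, -, hc₀c, hw1, -, -, hex, -⟩ := hgap.1
  obtain ⟨-, -, hslack, -⟩ := hgap.2
  -- the exact zero-slack flow from the same ball state, on the clock window `[0, c]`
  obtain ⟨z, hz, hzr⟩ := hball
  obtain ⟨S, F, hSF⟩ := hex S₀ ⟨z, hz, hzr⟩
  -- its step with amplitude slack (horizon `c ≥ c₀`)
  obtain ⟨τ₁, a, hstep, hmargin⟩ := hslack S₀ c S F ⟨z, hz, hzr⟩ hc₀c.le hSF
  -- the three closeness facts, then transfer the step to the pseudo-flow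
  obtain ⟨hfront, hballc, henv⟩ :=
    hclose L S₀ F₀ B₀ ⟨z, hz, hzr⟩ hB τ hτc S' F' hflow' S F hSF τ₁ a hstep hmargin
  exact ⟨τ₁, a, GappedFrontRobust.stepTo_transfer hε.le hθ₀θ.le hc₀c.le
    (fun k => zero_le_one.trans (hw1 k)) hstep (by linarith) hfront hballc henv⟩

/-! ### The reduction -/

/-- **`RelayFrontStep` from ONE format-v2 certificate with thin tail.** If SOME four-mode table
`α⋆` whose nonlinearity has the completion-relay rows admits, at the dyadic scale ratio `ε₀ = 1`,
format-v2 gap data `GapData₂ σ 1 i₀ α⋆ X₀ Z w r ρ θ₀ θ c₀ c env₀` (datum mode `i₀` with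
`X₀ i₀ ≠ 0`) together with the thin-tail clause `TailThin 1 w r`, then the crux `RelayFrontStep`
of route `CompletionRelayChain` holds: for every `α ∈ E₂(64)` with the relay rows the certificate
transports to `α` (same nonlinearity), and the (step) clause of the closed crux K_B₂
(`RelayFrontStep.robustStep_of_gapData₂`) yields the margin `η`, the envelope and
`RobustStep 1 θ c η i₀ α (ballDesc Z w r) env`, with the ball description holding at the rescaled
datum. MODEL lattice only; the certificate itself is NOT constructed here. [this file] -/
theorem completionRelayChain_relayFrontStep_of_gapData₂
    (hcert : ∃ αs : Fin 4 → Fin 4 → Fin 4 → ℤ × ℤ × ℤ → ℝ,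
      ((∀ (X : Fin 4 → ℤ → ℝ → ℝ) (n : ℤ) (t : ℝ), quadTerm 1 αs X 0 n t =
          -((1 + 1 : ℝ) ^ ((5 : ℝ) * n / 2) * (X 1 n t * X 1 n t)) +
            (1 + 1 : ℝ) ^ ((5 : ℝ) * ((n : ℝ) - 1) / 2) * (X 1 (n - 1) t * X 1 (n - 1) t)) ∧
        (∀ (X : Fin 4 → ℤ → ℝ → ℝ) (n : ℤ) (t : ℝ), quadTerm 1 αs X 1 n t =
          (1 + 1 : ℝ) ^ ((5 : ℝ) * n / 2) * (X 0 n t * X 1 n t - X 1 n t * X 0 (n + 1) t) -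
            (1 / 32 : ℝ) * ((1 + 1 : ℝ) ^ ((5 : ℝ) * n / 2) * (X 0 (n + 1) t * X 2 n t)) +
            (1 / 32 : ℝ) * ((1 + 1 : ℝ) ^ ((5 : ℝ) * ((n : ℝ) - 1) / 2) *
              (X 2 (n - 1) t * X 1 (n - 1) t))) ∧
        (∀ (X : Fin 4 → ℤ → ℝ → ℝ) (n : ℤ) (t : ℝ), quadTerm 1 αs X 2 n t =
          (1 / 32 : ℝ) * ((1 + 1 : ℝ) ^ ((5 : ℝ) * n / 2) *
            (X 0 (n + 1) t * X 1 n t - X 1 n t * X 1 (n + 1) t))) ∧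
        (∀ (X : Fin 4 → ℤ → ℝ → ℝ) (n : ℤ) (t : ℝ), quadTerm 1 αs X 3 n t = 0)) ∧
      ∃ (σ : ℝ) (i₀ : Fin 4) (X₀ : Fin 4 → ℝ) (Z : Set (Fin 4 → ℤ → ℝ)) (w : ℤ → ℝ)
        (r ρ θ₀ θ c₀ c : ℝ) (env₀ : ℤ → ℝ),
        X₀ i₀ ≠ 0 ∧ GapData₂ σ 1 i₀ αs X₀ Z w r ρ θ₀ θ c₀ c env₀ ∧ TailThin 1 w r) :
    Summit.NavierStokesRegularity.NavierStokesRegularity.Theses.CompletionRelayChain.RelayFrontStep := by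
  intro α hα hrows
  obtain ⟨αs, hrows_s, σ, i₀, X₀, Z, w, r, ρ, θ₀, θ, c₀, c, env₀, hX₀, hgap_s, hthin⟩ := hcert
  -- transport the certificate from `αs` to `α` (same nonlinearity)
  have hq := RelayFrontStep.quadTerm_eq_of_relayRows αs α hrows_s hrows
  have hgap : GapData₂ σ 1 i₀ α X₀ Z w r ρ θ₀ θ c₀ c env₀ :=
    RelayFrontStep.gapData₂_congr_quadTerm hgap_s hq
  -- the (step) clause of the closed crux K_B₂
  obtain ⟨η, env, hη, hstep⟩ := RelayFrontStep.robustStep_of_gapData₂ hα one_pos hgap hthin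
  obtain ⟨-, -, -, hθ₀, hθ₀θ, hθ, hc₀, hc₀c, -⟩ := hgap.1.signs
  exact ⟨θ, c, η, i₀, X₀, ballDesc Z w r, env, by linarith, hθ, by linarith, hη, hX₀,
    hgap.datum_mem_ball _, hstep⟩

end Summit.NavierStokesRegularity.NavierStokesRegularity.Theorems
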